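import Summits.AtomisticToContinuum.Crystallization.Theorems.ExcessDecayLiouvilleStepEnergyBound
import Summits.AtomisticToContinuum.Crystallization.Theorems.ExcessDecayLiouvilleCurrenciesNNAbs
import Summits.AtomisticToContinuum.Crystallization.Theorems.ExcessDecayLiouvilleCurrenciesPolyAbs

/-!
# Route `ExcessDecayLiouville`: the correction energy in mass currencies, forcing absorbed (nonlinear half, XXV″)

Harmonic-replacement architecture for item `ExcessDecay` (stmt-AtomisticToContinuum-9334), nonlinear half.
`NN_le_poly_abs` and `step_energy_le_abs` are `NN_le_poly_mass` / `step_energy_le_mass` on the absorbed-forcing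
gradient currency (`NN_le_currency_abs`, `NN_currency_le_poly'`): the gradient quintic has the doubled
coefficients `2𝔮₁, …, 2𝔮₄` and the forcing coefficient `(2048/κ²)(1178/189)² Φ₀²` (quadratic in the forcing
floor, free of the mass constant), and the flux smallness is `4·10⁶ Λ ≤ κ/16`.
All `[folklore]`; helper lemmas, nothing here closes an item.
-/

noncomputable section

namespace Summit.AtomisticToContinuum.Crystallization.Theorems.ExcessDecayLiouville

open scoped BigOperators Topology InnerProductSpace RealInnerProductSpace Classical
open Literature.MathematicalPhysics.StatisticalMechanics
open Summit.AtomisticToContinuum.Crystallization.Theorems.PhononStabilityNegative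

-- Local notation: the force-constant map `K(e)w = h(|e|²)w + 2⟪e,w⟫h′(|e|²)e`.
local notation3 "𝕂[" e "] " w:max =>
  (-((‖e‖ ^ 2)⁻¹) ^ 7 + ((‖e‖ ^ 2)⁻¹) ^ 4) • w + (2 * ⟪e, w⟫ * (7 * ((‖e‖ ^ 2)⁻¹) ^ 8 - 4 * ((‖e‖ ^ 2)⁻¹) ^ 5)) • e
-- Local notation: the pair force `F(x) = h(|x|²) x`.
local notation3 "𝐅[" x "]" => ((-((‖x‖ ^ 2)⁻¹) ^ 7 + ((‖x‖ ^ 2)⁻¹) ^ 4) • x)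
set_option quotPrecheck false in
-- Local notation: ball indicator.
local notation "𝟙ᵇ[" x ", " c ", " R "]" => (if dist (x : EuclideanSpace ℝ (Fin 3)) c ≤ R then (1 : ℝ) else 0)

section

variable {X : Set (EuclideanSpace ℝ (Fin 3))} {c : EuclideanSpace ℝ (Fin 3)} {r ε δ κ : ℝ}
  {t : Fin 2 → EuclideanSpace ℝ (Fin 3)} {A : EuclideanSpace ℝ (Fin 3) →L[ℝ] EuclideanSpace ℝ (Fin 3)}
  {π : EuclideanSpace ℝ (Fin 3) → EuclideanSpace ℝ (Fin 3)}
  {aff : (EuclideanSpace ℝ (Fin 3)) → (EuclideanSpace ℝ (Fin 3))} {a : Fin 2 → EuclideanSpace ℝ (Fin 3)}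
  {B : (EuclideanSpace ℝ (Fin 3)) →L[ℝ] (EuclideanSpace ℝ (Fin 3))} {c₀ : EuclideanSpace ℝ (Fin 3)}

variable (hA : Adm₀ A) (hI : Inner₀ t A)

set_option quotPrecheck false in
-- Local notation: the operator row `(L v)(p)`.
local notation "𝕃" v:max " @ " p:max =>
  tsum (fun q : Sites₀ t A => (if ((p : Sites₀ t A) : EuclideanSpace ℝ (Fin 3)) ≠ q then
    𝕂[((p : Sites₀ t A) : EuclideanSpace ℝ (Fin 3)) - q] (v ((p : Sites₀ t A) : EuclideanSpace ℝ (Fin 3)) - v q) else 0))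
set_option quotPrecheck false in
-- Local notation: the finite near-neighbour form on the ball of radius `X` about `c₀`.
local notation "NN[" v ", " X "]" =>
  (∑ p ∈ (finite_sites_dist_le (t := t) (A := A) hA hI c₀ X).toFinset,
    ∑ q ∈ (finite_sites_dist_le (t := t) (A := A) hA hI c₀ X).toFinset,
      (if p ≠ q ∧ dist p q ≤ 11 / 10 then ‖v p - v q‖ ^ 2 else (0 : ℝ)))
set_option quotPrecheck false in
-- local mass on the ball of radius `X` about `c₀`
local notation "𝐌[" f ", " X "]" =>
  tsum (fun p : Sites₀ t A => ‖f (p : EuclideanSpace ℝ (Fin 3))‖ ^ 2 * 𝟙ᵇ[p, c₀, X])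
set_option quotPrecheck false in
-- weighted far mass with floor `Y` about `c₀`
local notation "𝐉[" f ", " Y "]" =>
  tsum (fun q : Sites₀ t A => ‖f (q : EuclideanSpace ℝ (Fin 3))‖ ^ 2 * (max (dist (q : EuclideanSpace ℝ (Fin 3)) c₀) Y)⁻¹ ^ 8)

-- the gradient currency as a quintic: coefficients
local notation "𝔮₁[" κ ", " Λ' ", " C "]" => ((64 * (2 / κ) * (131072 * (38 * 4 ^ 5 * (1024 / (23 / 25 : ℝ) ^ 3)) +
          Λ' * 3200000 * (1024 / (23 / 25 : ℝ) ^ 3) * 72704) * C + 64 * 120 ^ 5 * 327680 * C +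
        4 / κ * (Λ' * 32768 * 256 * C + 1245184 * 4096 * C)))
local notation "𝔮₂[" κ ", " Λ' ", " Dv ", " r "]" => ((4 / κ * (Λ' * 32768 * 8192 * (7 * r / 8) ^ 3 * Dv ^ 2 / ((r / 4) ^ 7 * 4) +
        1245184 * 8192 * (7 * r / 8) ^ 3 * Dv ^ 2 / (r / 4) ^ 7)))
local notation "𝔮₃[" κ ", " Λ' ", " D₀ ", " r "]" => ((4 / κ * (Λ' * 32768 * (32 * r ^ 3 * ((3 * r / 8)⁻¹ ^ 8 * (D₀ / 2) ^ 2)))))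
local notation "𝔮₄[" κ ", " C "]" => ((2 ^ (5 + 1) * (2 / κ * (19 * 16 * (1024 / ((23 / 25 : ℝ) ^ 3 * (23 / 25 : ℝ) ^ 3))) +
        16 * (11 / 10 : ℝ) ^ 8 * (1024 / ((23 / 25 : ℝ) ^ 3 * (23 / 25 : ℝ) ^ 3))) * (32 * 4 ^ 6) * C))
local notation "𝔮₅[" κ ", " C ", " Φ₀ "]" => ((4 / κ * (16 * Real.sqrt (2048 * C) * Φ₀)))

include hA hI in
/-- **The absorbed-forcing gradient currency as a quintic, from the mass bounds**: `NN[v, a] ≤ Σ_k 𝔮_k a^k` for `max(1, ρ) ≤ a`, `32a ≤ r`.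
[folklore] -/
theorem NN_le_poly_abs (hκ0 : 0 < κ)
    (hκ : ∀ v : (EuclideanSpace ℝ (Fin 3)) → (EuclideanSpace ℝ (Fin 3)), (Function.support v).Finite →
      Function.support v ⊆ Sites₀ t A → κ * nnForm t A v ≤ ∑' p : Sites₀ t A, ⟪𝕃 v @ p, v p⟫)
    (hX : X.Finite) (hequil : Equil₀ X) (hr : 8 ≤ r)
    (hπ : ∀ s' ∈ Sites₀ t A, dist s' c ≤ r → π s' ∈ X ∧ dist (π s') s' ≤ ε)
    (hinj : ∀ s₁ ∈ Sites₀ t A, ∀ s₂ ∈ Sites₀ t A, dist s₁ c ≤ r → dist s₂ c ≤ r → π s₁ = π s₂ → s₁ = s₂)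
    (SR : Finset (EuclideanSpace ℝ (Fin 3))) (hSR : ∀ x, x ∈ SR ↔ x ∈ Sites₀ t A ∧ dist x c ≤ r)
    (χ : EuclideanSpace ℝ (Fin 3) → ℝ) (hχ0 : ∀ q ∈ Sites₀ t A, q ∉ SR → χ q = 0) (hχS : ∀ x, x ∉ Sites₀ t A → χ x = 0)
    (hχabs : ∀ x, |χ x| ≤ 1) (hχone : ∀ q ∈ SR, dist q c ≤ r / 2 → χ q = 1)
    (haff : ∀ (m : Fin 2) (z : EuclideanSpace ℝ (Fin 3)), z ∈ Λ₀ → aff (t m + A z) = a m + B (t m + A z - c₀))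
    {D₀ : ℝ} (hD₀ : 0 ≤ D₀) (hD₀' : D₀ ≤ 1 / 10) (hsmall : ‖a 0 - a 1‖ + 2 * r * ‖B‖ ≤ 1 / 50)
    (v ut : (EuclideanSpace ℝ (Fin 3)) → (EuclideanSpace ℝ (Fin 3)))
    (hvdef : v = fun x => χ x • ((π x - x) - aff x)) (hudef : ut = fun x => (π x - x) - aff x)
    (hD : ∀ x ∈ SR, ‖ut x‖ ≤ D₀ / 2)
    (hΛκ : 4000000 * (210000 * ((25 / 23) * (D₀ + ‖a 0 - a 1‖) + ‖B‖)) ≤ κ / 16)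
    (hv : (Function.support v).Finite)
    (hc₀ : dist c₀ c ≤ r / 8)
    (φ : (EuclideanSpace ℝ (Fin 3)) → (EuclideanSpace ℝ (Fin 3)))
    (hφdef : φ = fun s : EuclideanSpace ℝ (Fin 3) =>
          (-(∑ s' ∈ SR.erase s, 𝐅[(s - s') + (aff s - aff s')]) -
            (∑ q ∈ (hX.toFinset.erase (π s)) \ ((SR.erase s).image π),
              (deriv lennardJones (dist (π s) q) / dist (π s) q) • (π s - q)) +
            ((∑ s' ∈ SR.erase s, 𝕂[s - s'] ((1 - χ s') • ((π s' - s') - aff s'))) +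
              ∑' q : ↑((SR.subtype (· ∈ Sites₀ t A) : Set (Sites₀ t A)))ᶜ,
                (if s ≠ (q : EuclideanSpace ℝ (Fin 3)) then 𝕂[s - (q : EuclideanSpace ℝ (Fin 3))] ((π s - s) - aff s) else 0))))
    {Φ₀ : ℝ} (hΦ₀ : 0 ≤ Φ₀)
    (hφ : ∀ (p : Sites₀ t A), (p : EuclideanSpace ℝ (Fin 3)) ∈ SR → dist (p : EuclideanSpace ℝ (Fin 3)) c ≤ r / 4 → ‖φ p‖ ≤ Φ₀)
    {C ρ Dv : ℝ} (hC : 0 ≤ C)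
    (hmass : ∀ Xr : ℝ, 1 ≤ Xr → ρ ≤ Xr → Xr ≤ r / 4 → 𝐌[v, Xr] ≤ 32 * C * Xr ^ 6)
    (hvD : ∀ x, ‖v x‖ ≤ Dv)
    (hsupp : ∀ x ∈ Sites₀ t A, 7 * r / 8 < dist x c₀ → v x = 0)
    {a₁ : ℝ} (ha₁ : 1 ≤ a₁) (hρa : ρ ≤ a₁) (har : 32 * a₁ ≤ r) :
    NN[v, a₁] ≤ 2 * 𝔮₁[κ, (210000 * ((25 / 23) * (D₀ + ‖a 0 - a 1‖) + ‖B‖)), C] * a₁ +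
      2 * 𝔮₂[κ, (210000 * ((25 / 23) * (D₀ + ‖a 0 - a 1‖) + ‖B‖)), Dv, r] * a₁ ^ 2 +
      2 * 𝔮₃[κ, (210000 * ((25 / 23) * (D₀ + ‖a 0 - a 1‖) + ‖B‖)), D₀, r] * a₁ ^ 3 +
      2 * 𝔮₄[κ, C] * a₁ ^ 4 + (2048 / κ ^ 2 * (1178 / 189 : ℝ) ^ 2 * Φ₀ ^ 2) * a₁ ^ 5 := by
  have h := NN_le_currency_abs hA hI hκ0 hκ hX hequil hr hπ hinj SR hSR χ hχ0 hχS hχabs hχone haff hD₀ hD₀' hsmall v ut hvdef hudef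
    hD hΛκ hv hc₀ φ hφdef hΦ₀ hφ hC hmass hvD hsupp ha₁ hρa har
  exact h.trans (NN_currency_le_poly' ha₁ hκ0 hC (by linarith))

-- the statement alone is several hundred tokens of currencies; the final `gcongr` needs ~3·10⁵ heartbeats
set_option maxHeartbeats 400000 in
include hA hI in
/-- **The correction energy in the mass currencies, forcing absorbed** (see the module docstring): the `step_harmonic` shape with
`E₁ ≤ 32 C ρ'⁶`, `E₂ ≤ 32 C (2ρ')⁶`, `J₂ ≤ 𝐉-bound + far floor`, `NN₁ ≤ Σ 𝔮'_k a_c^k`, `a_c = ρ' + 10L + 20`.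
[folklore] -/
theorem step_energy_le_abs (hκ0 : 0 < κ)
    (hκ : ∀ v : (EuclideanSpace ℝ (Fin 3)) → (EuclideanSpace ℝ (Fin 3)), (Function.support v).Finite →
      Function.support v ⊆ Sites₀ t A → κ * nnForm t A v ≤ ∑' p : Sites₀ t A, ⟪𝕃 v @ p, v p⟫)
    (hX : X.Finite) (hequil : Equil₀ X) (hr : 8 ≤ r)
    (hπ : ∀ s' ∈ Sites₀ t A, dist s' c ≤ r → π s' ∈ X ∧ dist (π s') s' ≤ ε)
    (hinj : ∀ s₁ ∈ Sites₀ t A, ∀ s₂ ∈ Sites₀ t A, dist s₁ c ≤ r → dist s₂ c ≤ r → π s₁ = π s₂ → s₁ = s₂)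
    (SR : Finset (EuclideanSpace ℝ (Fin 3))) (hSR : ∀ x, x ∈ SR ↔ x ∈ Sites₀ t A ∧ dist x c ≤ r)
    (χ : EuclideanSpace ℝ (Fin 3) → ℝ) (hχ0 : ∀ q ∈ Sites₀ t A, q ∉ SR → χ q = 0) (hχS : ∀ x, x ∉ Sites₀ t A → χ x = 0)
    (hχabs : ∀ x, |χ x| ≤ 1) (hχone : ∀ q ∈ SR, dist q c ≤ r / 2 → χ q = 1)
    (haff : ∀ (m : Fin 2) (z : EuclideanSpace ℝ (Fin 3)), z ∈ Λ₀ → aff (t m + A z) = a m + B (t m + A z - c₀))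
    {D₀ : ℝ} (hD₀ : 0 ≤ D₀) (hD₀' : D₀ ≤ 1 / 10) (hsmall : ‖a 0 - a 1‖ + 2 * r * ‖B‖ ≤ 1 / 50)
    (v ut : (EuclideanSpace ℝ (Fin 3)) → (EuclideanSpace ℝ (Fin 3)))
    (hvdef : v = fun x => χ x • ((π x - x) - aff x)) (hudef : ut = fun x => (π x - x) - aff x)
    (hD : ∀ x ∈ SR, ‖ut x‖ ≤ D₀ / 2)
    (hΛκ : 4000000 * (210000 * ((25 / 23) * (D₀ + ‖a 0 - a 1‖) + ‖B‖)) ≤ κ / 16)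
    (hv : (Function.support v).Finite)
    (hc₀ : dist c₀ c ≤ r / 8)
    (φ : (EuclideanSpace ℝ (Fin 3)) → (EuclideanSpace ℝ (Fin 3)))
    (hφdef : φ = fun s : EuclideanSpace ℝ (Fin 3) =>
          (-(∑ s' ∈ SR.erase s, 𝐅[(s - s') + (aff s - aff s')]) -
            (∑ q ∈ (hX.toFinset.erase (π s)) \ ((SR.erase s).image π),
              (deriv lennardJones (dist (π s) q) / dist (π s) q) • (π s - q)) +
            ((∑ s' ∈ SR.erase s, 𝕂[s - s'] ((1 - χ s') • ((π s' - s') - aff s'))) +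
              ∑' q : ↑((SR.subtype (· ∈ Sites₀ t A) : Set (Sites₀ t A)))ᶜ,
                (if s ≠ (q : EuclideanSpace ℝ (Fin 3)) then 𝕂[s - (q : EuclideanSpace ℝ (Fin 3))] ((π s - s) - aff s) else 0))))
    {Φ₀ : ℝ} (hΦ₀ : 0 ≤ Φ₀)
    (hφ : ∀ (p : Sites₀ t A), (p : EuclideanSpace ℝ (Fin 3)) ∈ SR → dist (p : EuclideanSpace ℝ (Fin 3)) c ≤ r / 4 → ‖φ p‖ ≤ Φ₀)
    {C ρ Dv : ℝ} (hC : 0 ≤ C) (hρ1 : 1 ≤ ρ)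
    (hmass : ∀ Xr : ℝ, 1 ≤ Xr → ρ ≤ Xr → Xr ≤ r / 4 → 𝐌[v, Xr] ≤ 32 * C * Xr ^ 6)
    (hvD : ∀ x, ‖v x‖ ≤ Dv)
    (hsupp : ∀ x ∈ Sites₀ t A, 7 * r / 8 < dist x c₀ → v x = 0)
    -- the comparison radii
    {ρ' L Aφ : ℝ} (hρρ' : ρ ≤ ρ') (hL : 1 ≤ L) (hgeom : 32 * (ρ' + 10 * L + 20) ≤ r) (hAφ : 0 ≤ Aφ)
    {w : (EuclideanSpace ℝ (Fin 3)) → (EuclideanSpace ℝ (Fin 3))}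
    (hE : nnForm t A w ≤ 2 * (((Aφ +
        (210000 * ((25 / 23) * (2 * (D₀ / 2) + ‖a 0 - a 1‖) + ‖B‖)) * (3 * (1024 / ((23 / 25 : ℝ) ^ 3 * L ^ 5)) *
            Real.sqrt (∑ x ∈ SR.filter (fun p => dist p c₀ ≤ ρ'), ‖ut x‖ ^ 2) +
          Real.sqrt (1024 / ((23 / 25 : ℝ) ^ 3 * L ^ 5)) * Real.sqrt
            ((1024 / ((23 / 25 : ℝ) ^ 3 * L ^ 5)) * (∑ q ∈ SR.filter (fun q => dist q c₀ ≤ 2 * ρ'), ‖ut q‖ ^ 2) +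
              8192 * ρ' ^ 3 * ∑ q ∈ SR.filter (fun q => ¬ dist q c₀ ≤ 2 * ρ'), (dist q c₀)⁻¹ ^ 8 * ‖ut q‖ ^ 2))) *
          (400 * ρ' / 189 + 2)) ^ 2 +
        (4000000 * (210000 * ((25 / 23) * (2 * (D₀ / 2) + ‖a 0 - a 1‖) + ‖B‖)) *
          Real.sqrt (NN[v, ρ' + 10 * L + 20])) ^ 2) / κ ^ 2) :
    nnForm t A w ≤ 2 * (((Aφ +
        (210000 * ((25 / 23) * (2 * (D₀ / 2) + ‖a 0 - a 1‖) + ‖B‖)) * (3 * (1024 / ((23 / 25 : ℝ) ^ 3 * L ^ 5)) *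
            Real.sqrt (32 * C * ρ' ^ 6) +
          Real.sqrt (1024 / ((23 / 25 : ℝ) ^ 3 * L ^ 5)) * Real.sqrt
            ((1024 / ((23 / 25 : ℝ) ^ 3 * L ^ 5)) * (32 * C * (2 * ρ') ^ 6) +
              8192 * ρ' ^ 3 * ((4096 * C / (2 * ρ') ^ 2 + 8192 * (7 * r / 8) ^ 3 * Dv ^ 2 / ((r / 4) ^ 7 * (2 * ρ'))) +
                32 * r ^ 3 * ((3 * r / 8)⁻¹ ^ 8 * (D₀ / 2) ^ 2))))) *
          (400 * ρ' / 189 + 2)) ^ 2 +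
        (4000000 * (210000 * ((25 / 23) * (2 * (D₀ / 2) + ‖a 0 - a 1‖) + ‖B‖)) *
          Real.sqrt (2 * 𝔮₁[κ, (210000 * ((25 / 23) * (D₀ + ‖a 0 - a 1‖) + ‖B‖)), C] * (ρ' + 10 * L + 20) +
            2 * 𝔮₂[κ, (210000 * ((25 / 23) * (D₀ + ‖a 0 - a 1‖) + ‖B‖)), Dv, r] * (ρ' + 10 * L + 20) ^ 2 +
            2 * 𝔮₃[κ, (210000 * ((25 / 23) * (D₀ + ‖a 0 - a 1‖) + ‖B‖)), D₀, r] * (ρ' + 10 * L + 20) ^ 3 +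
            2 * 𝔮₄[κ, C] * (ρ' + 10 * L + 20) ^ 4 +
            (2048 / κ ^ 2 * (1178 / 189 : ℝ) ^ 2 * Φ₀ ^ 2) * (ρ' + 10 * L + 20) ^ 5)) ^ 2) / κ ^ 2 := by
  have hSRS : ∀ x ∈ SR, x ∈ Sites₀ t A := fun x hx => ((hSR x).1 hx).1
  have hr0 : 0 < r := by linarith
  have hρ'1 : 1 ≤ ρ' := hρ1.trans hρρ'
  have hρ'0 : 0 < ρ' := by linarith
  -- ũ = v on the sites of SR ∩ B_{r/2}(c)
  have huv : ∀ q ∈ SR, dist q c ≤ r / 2 → ut q = v q := by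
    intro q hq hqc
    rw [hvdef, hudef]; simp only []
    rw [hχone q hq hqc, one_smul]
  -- E₁, E₂
  have hE1 : ∑ x ∈ SR.filter (fun p => dist p c₀ ≤ ρ'), ‖ut x‖ ^ 2 ≤ 32 * C * ρ' ^ 6 := by
    calc _ = ∑ q ∈ SR.filter (fun q => dist q c₀ ≤ ρ'), ‖v q‖ ^ 2 := by
          refine Finset.sum_congr rfl fun q hq => ?_
          rw [Finset.mem_filter] at hq
          rw [huv q hq.1 (by have := dist_triangle q c₀ c; linarith)]
      _ ≤ 𝐌[v, ρ'] := sum_filter_le_mass hA hI v SR hSRS _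
      _ ≤ 32 * C * ρ' ^ 6 := hmass _ hρ'1 hρρ' (by linarith)
  have hE2 : ∑ q ∈ SR.filter (fun q => dist q c₀ ≤ 2 * ρ'), ‖ut q‖ ^ 2 ≤ 32 * C * (2 * ρ') ^ 6 := by
    calc _ = ∑ q ∈ SR.filter (fun q => dist q c₀ ≤ 2 * ρ'), ‖v q‖ ^ 2 := by
          refine Finset.sum_congr rfl fun q hq => ?_
          rw [Finset.mem_filter] at hq
          rw [huv q hq.1 (by have := dist_triangle q c₀ c; linarith)]
      _ ≤ 𝐌[v, 2 * ρ'] := sum_filter_le_mass hA hI v SR hSRS _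
      _ ≤ 32 * C * (2 * ρ') ^ 6 := hmass _ (by linarith) (by linarith) (by linarith)
  -- J₂
  have hsupp' : ∀ x, v x ≠ 0 → x ∈ Sites₀ t A := by
    intro x hx
    by_contra h
    apply hx
    rw [hvdef]; simp only []
    rw [hχS x h, zero_smul]
  have hJ2 : ∑ q ∈ SR.filter (fun q => ¬ dist q c₀ ≤ 2 * ρ'), (dist q c₀)⁻¹ ^ 8 * ‖ut q‖ ^ 2 ≤
      (4096 * C / (2 * ρ') ^ 2 + 8192 * (7 * r / 8) ^ 3 * Dv ^ 2 / ((r / 4) ^ 7 * (2 * ρ'))) +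
        32 * r ^ 3 * ((3 * r / 8)⁻¹ ^ 8 * (D₀ / 2) ^ 2) := by
    have h := farSum_le hA hI hr ut v SR hSR huv hD hv hc₀ (a := ρ' / 2) (by linarith) (by linarith)
    rw [show 4 * (ρ' / 2) = 2 * ρ' by ring] at h
    refine h.trans (add_le_add ?_ le_rfl)
    exact farMass_le_mass hA hI v hv hC (by linarith) (by linarith) hmass hvD hsupp hsupp' (by linarith) (by linarith)
  -- NN₁
  have hNN1 := NN_le_poly_abs hA hI hκ0 hκ hX hequil hr hπ hinj SR hSR χ hχ0 hχS hχabs hχone haff hD₀ hD₀' hsmall v ut hvdef hudef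
    hD hΛκ hv hc₀ φ hφdef hΦ₀ hφ hC hmass hvD hsupp (a₁ := ρ' + 10 * L + 20) (by linarith) (by linarith) hgeom
  -- monotonicity
  refine hE.trans ?_
  have hΛ0 : 0 ≤ 210000 * ((25 / 23) * (2 * (D₀ / 2) + ‖a 0 - a 1‖) + ‖B‖) := by positivity
  have hF0 : 0 ≤ 1024 / ((23 / 25 : ℝ) ^ 3 * L ^ 5) := by positivity
  have hρ'2 : 0 ≤ 400 * ρ' / 189 + 2 := by positivity
  gcongr

end

end Summit.AtomisticToContinuum.Crystallization.Theorems.ExcessDecayLiouville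

end
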